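import Summits.HubbardSuperconductivity.HubbardSuperconductivity.Theses.JosephsonMirror
import Summits.HubbardSuperconductivity.HubbardSuperconductivity.Theorems.JosephsonMirrorWindowDouble
import Literature.MathematicalPhysics.QuantumLattice.HubbardRingPerronFrobeniusProofs
import Literature.MathematicalPhysics.QuantumLattice.HubbardModelParticleHoleProofs
import Literature.MathematicalPhysics.QuantumLattice.HubbardGaugeBound
import Literature.MathematicalPhysics.QuantumLattice.HubbardHubbardModelEtaPairingProofs

/-!
# Route `JosephsonMirror` — the pair bridge gives Josephson gain (`JmPairBridgeGivesGain`)

Support item stmt-HubbardSuperconductivity-2231 of route `JosephsonMirror` (sub-problem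
`HubbardSuperconductivity`): the EASY (Koma–Tasaki) half of the Josephson mirror, at finite volume.
For even `L`, `δ ∈ (0, 1/2)`, `J ≥ 0` and unit sector ground states `φ ∈ (N_L, S^z = 0)`,
`χ ∈ (N_L - 2, S^z = 0)` of `hubbardTorus 2 L 1 U`,

  `J · |⟨χ, Δ_d φ⟩|² / L² ≤ E_L(0) - E_L(J)`,

where `E_L(J)` is the lowest energy of the window double
`H_L(J) = A ⊗ 1 + 1 ⊗ Aᵀ - J (D ⊗ D̄ + Dᴴ ⊗ D̄ᴴ)` (`A = H - μ_L N`, `D = L⁻¹ Δ_d`, `D̄ = (Dᴴ)ᵀ`)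
on the mirror window `S_L = (N_L, N_L) ⊕ (N_L - 2, N_L - 2)` (both layers at `S^z = 0`), with the
balancing chemical potential `μ_L = (e(N_L) - e(N_L - 2)) / 2`.

It is the instance of the abstract Kronecker-double lemma `gain_le_minEnergyOn_sub`
(`Theorems/JosephsonMirrorWindowDouble`) with the blocks `(N_L, S^z = 0)` and `(N_L - 2, S^z = 0)`
(Lieb's `(n, n)` and `(n-1, n-1)` sectors, `N_L = 2n`), the common Rayleigh floor / eigenvalue
`a = e(N_L) - μ_L N_L = e(N_L - 2) - μ_L (N_L - 2)` (this is where the balancing `μ_L` enters; the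
floors are the sector variational principle `szSector_groundState`, the eigenvalue equations are
the ground-state property plus `N φ = N_L φ`), and `D = L⁻¹ Δ_d`.

Sources: T. Koma, H. Tasaki, J. Stat. Phys. 76 (1994) 745 (LRO ⇒ SSB direction, §3.4 tower
states); E. H. Lieb, Phys. Rev. Lett. 62 (1989) 1201 (the `W`-matrix packaging, the `S^z = 0`
sector). No new definitions.
-/

-- the mandated namespace `Summit.<Summit>.<Problem>.Theorems` repeats `HubbardSuperconductivity`
-- (single-problem summit, D-0017), which the `dupNamespace` linter flags on every declaration
set_option linter.dupNamespace false

namespace Summit.HubbardSuperconductivity.HubbardSuperconductivity.Theorems.JosephsonMirror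

open Matrix Literature.MathematicalPhysics.QuantumLattice
open Summit.HubbardSuperconductivity.HubbardSuperconductivity.Theses.JosephsonMirror
open scoped Kronecker ComplexOrder

section Torus

/-- The number of up electrons of a configuration, as a filtered count (general `Λ` version of
`card_upPart_eq`). [folklore] -/
theorem card_upPart_eq_card_filter {Λ : Type*} [LinearOrder Λ] [Fintype Λ] (s : Finset (Orb Λ)) :
    (upPart s).card = (s.filter fun i => (ofLex i).2 = 0).card := by
  rw [show (s.filter fun i => (ofLex i).2 = 0) = (upPart s).image (fun x => orb x 0) from ?_,
    Finset.card_image_of_injective _ (fun x y h => (orb_inj.1 h).1)]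
  ext i
  simp only [Finset.mem_filter, Finset.mem_image, mem_upPart]
  constructor
  · rintro ⟨hi, h0⟩
    refine ⟨(ofLex i).1, ?_, ?_⟩ <;>
    · have : orb (ofLex i).1 0 = i := by rw [← h0]; exact toLex_ofLex i
      simp [this, hi]
  · rintro ⟨x, hx, rfl⟩
    exact ⟨hx, rfl⟩

/-- The number of down electrons of a configuration, as a filtered count. [folklore] -/
theorem card_downPart_eq_card_filter {Λ : Type*} [LinearOrder Λ] [Fintype Λ]
    (s : Finset (Orb Λ)) :
    (downPart s).card = (s.filter fun i => (ofLex i).2 = 1).card := by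
  rw [show (s.filter fun i => (ofLex i).2 = 1) = (downPart s).image (fun x => orb x 1) from ?_,
    Finset.card_image_of_injective _ (fun x y h => (orb_inj.1 h).1)]
  ext i
  simp only [Finset.mem_filter, Finset.mem_image, mem_downPart]
  constructor
  · rintro ⟨hi, h0⟩
    refine ⟨(ofLex i).1, ?_, ?_⟩ <;>
    · have : orb (ofLex i).1 1 = i := by rw [← h0]; exact toLex_ofLex i
      simp [this, hi]
  · rintro ⟨x, hx, rfl⟩
    exact ⟨hx, rfl⟩

/-- The block predicate of the window (`|s| = 2n`, as many up as down electrons) is Lieb's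
`(n, n)` sector condition. [folklore] -/
theorem block_iff {Λ : Type*} [LinearOrder Λ] [Fintype Λ] (n : ℕ) (s : Finset (Orb Λ)) :
    (s.card = 2 * n ∧ (s.filter fun o => (ofLex o).2 = 0).card =
        (s.filter fun o => (ofLex o).2 = 1).card) ↔
      ((upPart s).card = n ∧ (downPart s).card = n) := by
  rw [← card_upPart_eq_card_filter, ← card_downPart_eq_card_filter, card_eq_upPart_add_downPart]
  omega

/-- On the vectors supported in the block `(2n, S^z = 0)` the grand-canonical torus Hamiltonian
`A = H - μ N` is bounded below by `e(2n) - μ · 2n` (sector variational principle plus `N = 2n`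
on the block). Tasaki (2020) §2.2. [folklore] -/
theorem block_rayleigh_lower (L : ℕ) [NeZero L] (U μ : ℝ) {n : ℕ} (hn : n ≤ L ^ 2)
    (v : Fock (Orb (FermionTorus 2 L)))
    (hv : ∀ s, ¬ (s.card = 2 * n ∧ (s.filter fun o => (ofLex o).2 = 0).card =
        (s.filter fun o => (ofLex o).2 = 1).card) → v s = 0) :
    ((hubbardTorus 2 L 1 U).minEnergyOn (szSector (2 * n) 0) - μ * (2 * n : ℕ)) *
        (star v ⬝ᵥ v).re ≤ (star v ⬝ᵥ hubbardTorusWith 2 L 1 U μ *ᵥ v).re := by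
  have hsec : IsInSector n n v := fun s hs => hv s fun h => hs ((block_iff n s).1 h)
  have hN : IsNParticle (2 * n) v := by
    have := hsec.isNParticle
    rwa [← two_mul] at this
  have hcard : n ≤ Fintype.card (FermionTorus 2 L) := by rwa [card_fermionTorus]
  have hlow := (szSector_groundState (fermionTorusGraph 2 L) 1 U hcard).2 v hsec
  have hA : hubbardTorusWith 2 L 1 U μ *ᵥ v =
      hubbardTorus 2 L 1 U *ᵥ v - ((μ : ℂ) * ((2 * n : ℕ) : ℂ)) • v := by
    rw [hubbardTorusWith_eq, sub_mulVec, smul_mulVec, totalNumber_mulVec_of_isNParticle hN,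
      smul_smul]
  rw [hA, dotProduct_sub, dotProduct_smul, Complex.sub_re, smul_eq_mul, ← Complex.ofReal_natCast,
    ← Complex.ofReal_mul, Complex.re_ofReal_mul, sub_mul]
  have : (hubbardTorus 2 L 1 U).minEnergyOn (szSector (2 * n) 0) * (star v ⬝ᵥ v).re ≤
      (star v ⬝ᵥ hubbardTorus 2 L 1 U *ᵥ v).re := hlow
  linarith

/-- **`JmPairBridgeGivesGain`** (stmt-HubbardSuperconductivity-2231): the finite-volume pair bridge
gives linear Josephson gain of the window double — for even `L`, `δ ∈ (0, 1/2)`, `J ≥ 0` and unit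
sector ground states `φ ∈ (N_L, 0)`, `χ ∈ (N_L - 2, 0)`:
`J · |⟨χ, Δ_d φ⟩|² / L² ≤ E_L(0) - E_L(J)`. Instance of `gain_le_minEnergyOn_sub` with the blocks
`(N_L, S^z = 0)`, `(N_L - 2, S^z = 0)`, the common Rayleigh floor / eigenvalue
`a = e(N_L) - μ_L N_L = e(N_L - 2) - μ_L (N_L - 2)` (balancing `μ_L`), and `D = L⁻¹ Δ_d`.
Koma–Tasaki, J. Stat. Phys. 76 (1994) 745 (LRO ⇒ SSB direction); Lieb, PRL 62 (1989) 1201.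
[folklore] -/
theorem jmPairBridgeGivesGain_proof :
    Summit.HubbardSuperconductivity.HubbardSuperconductivity.Theses.JosephsonMirror.JmPairBridgeGivesGain := by
  unfold JmPairBridgeGivesGain
  intro L _ U δ J hE hδ hJ φ χ hφ hφ1 hχ hχ1 ι N H μ A D Hd good S E
  -- the filling: `N = 2n` with `1 ≤ n ≤ L²`
  set n : ℕ := ⌊(1 - δ) * (L : ℝ) ^ 2 / 2⌋₊ with hn
  have hNn : N = 2 * n := rfl
  have hL2 : (2 : ℝ) ≤ L := by
    have h0 : L ≠ 0 := NeZero.ne L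
    obtain ⟨k, hk⟩ := hE
    have : 2 ≤ L := by omega
    exact_mod_cast this
  have hn1 : 1 ≤ n := by
    rw [hn]
    refine Nat.le_floor ?_
    rw [Nat.cast_one, le_div_iff₀ (by norm_num : (0 : ℝ) < 2)]
    have hδ2 : 1 / 2 ≤ 1 - δ := by linarith [hδ.2]
    nlinarith [hδ2, hL2]
  have hnL : n ≤ L ^ 2 := by
    rw [hn]
    refine Nat.floor_le_of_le ?_
    have hδ0 : 1 - δ ≤ 1 := by linarith [hδ.1]
    have hL0 : (0 : ℝ) ≤ (L : ℝ) ^ 2 := by positivity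
    push_cast
    nlinarith
  have hn'L : n - 1 ≤ L ^ 2 := le_trans (Nat.sub_le n 1) hnL
  have hN2 : N - 2 = 2 * (n - 1) := by omega
  have hN2' : ((N - 2 : ℕ) : ℝ) = (N : ℝ) - 2 := by
    rw [Nat.cast_sub (by omega)]
    norm_num
  -- energies and the balancing chemical potential
  set e₁ : ℝ := H.minEnergyOn (szSector N 0) with he₁
  set e₂ : ℝ := H.minEnergyOn (szSector (N - 2) 0) with he₂
  have hμ : μ = (e₁ - e₂) / 2 := rfl
  set a : ℝ := e₁ - μ * N with ha
  have ha₂ : a = e₂ - μ * ((N - 2 : ℕ) : ℝ) := by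
    rw [hN2', ha, hμ]
    ring
  have hAherm : A.IsHermitian := isHermitian_hamiltonianWith _ 1 U μ
  -- block predicates
  set F : ι → Prop := fun s =>
    (s.filter fun o => (ofLex o).2 = 0).card = (s.filter fun o => (ofLex o).2 = 1).card with hF
  set P₁ : ι → Prop := fun s => s.card = N ∧ F s with hP₁
  set P₂ : ι → Prop := fun s => s.card = N - 2 ∧ F s with hP₂
  have h12 : ∀ s, P₁ s → ¬ P₂ s := by
    rintro s ⟨h1, -⟩ ⟨h2, -⟩
    omega
  have hgood : ∀ s t, good (s, t) → (P₁ s ∧ P₁ t) ∨ (P₂ s ∧ P₂ t) := by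
    rintro s t ⟨h | h, hs, ht⟩
    · exact Or.inl ⟨⟨h.1, hs⟩, ⟨h.2, ht⟩⟩
    · exact Or.inr ⟨⟨h.1, hs⟩, ⟨h.2, ht⟩⟩
  have hgood₁ : ∀ s t, P₁ s → P₁ t → good (s, t) := fun s t hs ht =>
    ⟨Or.inl ⟨hs.1, ht.1⟩, hs.2, ht.2⟩
  have hgood₂ : ∀ s t, P₂ s → P₂ t → good (s, t) := fun s t hs ht =>
    ⟨Or.inr ⟨hs.1, ht.1⟩, hs.2, ht.2⟩
  have hS : ∀ ψ, ψ ∈ S ↔ ∀ p, ¬ good p → ψ p = 0 := by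
    intro ψ
    simp only [S, Submodule.mem_iInf, LinearMap.mem_ker, LinearMap.proj_apply]
  -- Rayleigh floors on the two blocks
  have hA₁ : ∀ v : ι → ℂ, (∀ s, ¬ P₁ s → v s = 0) →
      a * (star v ⬝ᵥ v).re ≤ (star v ⬝ᵥ A *ᵥ v).re := by
    intro v hv
    have h := block_rayleigh_lower L U μ hnL v (by simpa [hP₁, hF, hNn] using hv)
    rw [ha, hNn]
    exact h
  have hA₂ : ∀ v : ι → ℂ, (∀ s, ¬ P₂ s → v s = 0) →
      a * (star v ⬝ᵥ v).re ≤ (star v ⬝ᵥ A *ᵥ v).re := by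
    intro v hv
    have h := block_rayleigh_lower L U μ hn'L v (by simpa [hP₂, hF, hN2] using hv)
    rw [← hN2] at h
    rw [ha₂]
    exact h
  -- the two ground states
  obtain ⟨hφmem, -, hHφ⟩ := hφ
  obtain ⟨hχmem, -, hHχ⟩ := hχ
  have hφsec : IsInSector n n φ := (mem_szSector_two_mul_zero_iff n φ).1 (hNn ▸ hφmem)
  have hχsec : IsInSector (n - 1) (n - 1) χ :=
    (mem_szSector_two_mul_zero_iff (n - 1) χ).1 (hN2 ▸ hχmem)
  have hφP : ∀ s, ¬ P₁ s → φ s = 0 := fun s hs =>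
    hφsec s fun h => hs (by simpa [hP₁, hF, hNn] using (block_iff n s).2 h)
  have hχP : ∀ s, ¬ P₂ s → χ s = 0 := fun s hs =>
    hχsec s fun h => hs (by simpa [hP₂, hF, hN2] using (block_iff (n - 1) s).2 h)
  have hφN : IsNParticle N φ := (mem_szSector_iff N 0 φ).1 hφmem |>.1
  have hχN : IsNParticle (N - 2) χ := (mem_szSector_iff (N - 2) 0 χ).1 hχmem |>.1
  have hAφ : A *ᵥ φ = (a : ℂ) • φ := by
    show hubbardTorusWith 2 L 1 U μ *ᵥ φ = (a : ℂ) • φ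
    rw [hubbardTorusWith_eq, sub_mulVec, smul_mulVec, totalNumber_mulVec_of_isNParticle hφN,
      smul_smul]
    change H *ᵥ φ - _ = _
    rw [hHφ, ← sub_smul, ha]
    push_cast
    rfl
  have hAχ : A *ᵥ χ = (a : ℂ) • χ := by
    show hubbardTorusWith 2 L 1 U μ *ᵥ χ = (a : ℂ) • χ
    rw [hubbardTorusWith_eq, sub_mulVec, smul_mulVec, totalNumber_mulVec_of_isNParticle hχN,
      smul_smul]
    change H *ᵥ χ - _ = _
    rw [hHχ, ← sub_smul, ha₂]
    push_cast
    rfl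
  -- the abstract gain bound
  have key := gain_le_minEnergyOn_sub A D hAherm P₁ P₂ h12 good hgood hgood₁ hgood₂ S hS a hA₁ hA₂
    φ χ hφP hχP hφ1 hχ1 hAφ hAχ hJ
  -- `D = L⁻¹ Δ_d`
  have hL0 : (0 : ℝ) < L := by linarith
  have hD : ‖star χ ⬝ᵥ D *ᵥ φ‖ ^ 2 =
      ‖star χ ⬝ᵥ pairField dWaveFormFactor L *ᵥ φ‖ ^ 2 / (L : ℝ) ^ 2 := by
    show ‖star χ ⬝ᵥ (((L : ℂ))⁻¹ • pairField dWaveFormFactor L) *ᵥ φ‖ ^ 2 = _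
    rw [smul_mulVec, dotProduct_smul, smul_eq_mul, norm_mul, norm_inv, Complex.norm_natCast,
      mul_pow, inv_pow]
    ring
  rw [hD, ← mul_div_assoc] at key
  exact key

end Torus

end Summit.HubbardSuperconductivity.HubbardSuperconductivity.Theorems.JosephsonMirror
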